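import Mathlib

/-!
# Stub `stub_step` of crux `BoundaryTwoArmDecay` (stmt-CriticalPhenomena-0911), part 2: the real-variable
# inequalities of the bootstrap round

Helper file for the stub `stub_step` (ONE ROUND of the bootstrap) of the crux skeleton
`Cruxes/BoundaryTwoArmDecay/Lines/staircase_bootstrap_floor_decoupling.lean` (line
`staircase-bootstrap-floor-decoupling`, crux `PercLowPointHalfSpace.BoundaryTwoArmDecay`); lands with
`--supports stmt-CriticalPhenomena-0911`.  Pure real analysis, no percolation:

* `absorb` — the ABSORPTION step: from `n^{-s} P ≤ P_conf ≤ P₁ + P₂`, the census `P₁ ≤ C₁ k e`, Markov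
  `(k+1) P₂ ≤ P S` and the choice `2 n^s S ≤ k + 1`, conclude `P ≤ 2 C₁⁺ k e n^s`;
* `pow_weight_le` — the dyadic weight `(2^k)² (2^k)^{-a} ≤ n^{max 0 (2-a)}` for `2^k ≤ n`;
* `natLog_two_le` — `log₂ n + 1 ≤ (1 + 2/δ) n^δ`;
* `even_bound` — DYADIC AVERAGING: an antitone `f` with `f m ≤ C₂ m^γ e_m` (`m ≥ N₀`) and
  `Σ_{m ∈ [N, 2N]} e_m ≤ C_t N^{t-2}` satisfies `f (2N) ≤ C₂ 2^γ C_t N^{γ + t - 3}`;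
* `decay_of_eventually` — from `f (2N) ≤ C₃ N^{-β}` for `N ≥ N₁`, `f` antitone and `f ≤ 1`:
  `f n ≤ C n^{-β}` for all `n ≥ 1`.
-/

namespace Summit.CriticalPhenomena.PercolationContinuityZ3.Theorems.BoundaryTwoArmDecay

namespace StubStep

open Finset

/-! ### Absorption -/

/-- **Absorption.** With `x = n^s > 0`: if `x⁻¹ P ≤ P_c ≤ P₁ + P₂`, `P₁ ≤ C₁ k e`, `(k + 1) P₂ ≤ P S` and
`2 x S ≤ k + 1` (all quantities non-negative), then `P ≤ 2 C₁⁺ k e x`. -/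
theorem absorb {P Pc P₁ P₂ e S k x C₁ : ℝ} (hx : 0 < x) (hP : 0 ≤ P) (hS : 0 ≤ S) (hk : 0 ≤ k)
    (he : 0 ≤ e) (hP₂ : 0 ≤ P₂) (hconf : x⁻¹ * P ≤ Pc) (hsplit : Pc ≤ P₁ + P₂)
    (hcensus : P₁ ≤ C₁ * k * e) (hmarkov : (k + 1) * P₂ ≤ P * S) (hkS : 2 * x * S ≤ k + 1) :
    P ≤ 2 * max C₁ 0 * k * e * x := by
  -- Step 1: `2 x P₂ ≤ P`.
  have h2xP₂ : 2 * x * P₂ ≤ P := by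
    rcases hS.eq_or_lt with hS0 | hSpos
    · -- `S = 0`: then `(k+1) P₂ ≤ 0`, so `P₂ = 0`.
      rw [← hS0, mul_zero] at hmarkov
      have hP₂0 : P₂ ≤ 0 := by
        rcases le_or_gt P₂ 0 with hle | hpos
        · exact hle
        · have : 0 < (k + 1) * P₂ := mul_pos (by linarith) hpos
          linarith
      have hP₂z : P₂ = 0 := le_antisymm hP₂0 hP₂
      rw [hP₂z, mul_zero]
      exact hP
    · have h1 : 2 * x * S * P₂ ≤ (k + 1) * P₂ := mul_le_mul_of_nonneg_right hkS hP₂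
      have h2 : S * (2 * x * P₂) ≤ S * P := by nlinarith
      exact le_of_mul_le_mul_left h2 hSpos
  -- Step 2: `P ≤ x C₁ k e + x P₂`.
  have hP' : P ≤ x * (C₁ * k * e) + x * P₂ := by
    have h := mul_le_mul_of_nonneg_left (hconf.trans (hsplit.trans (add_le_add hcensus le_rfl))) hx.le
    rwa [← mul_assoc, mul_inv_cancel₀ hx.ne', one_mul, mul_add] at h
  -- Step 3: replace `C₁` by `C₁⁺` and absorb.
  have hC : x * (C₁ * k * e) ≤ x * (max C₁ 0 * k * e) :=
    mul_le_mul_of_nonneg_left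
      (mul_le_mul_of_nonneg_right (mul_le_mul_of_nonneg_right (le_max_left _ _) hk) he) hx.le
  nlinarith

/-! ### The dyadic weight and the logarithm -/

/-- The dyadic weight: for `2^k ≤ n` (`n ≥ 1`), `(2^k)² · (2^k)^{-a} ≤ n^{max 0 (2 - a)}`. -/
theorem pow_weight_le {a : ℝ} {n k : ℕ} (hn : 1 ≤ n) (hk : 2 ^ k ≤ n) :
    ((2 : ℝ) ^ k) ^ 2 * ((2 : ℝ) ^ k) ^ (-a) ≤ (n : ℝ) ^ (max 0 (2 - a)) := by
  have h2k : (0 : ℝ) < (2 : ℝ) ^ k := by positivity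
  rw [← Real.rpow_two, ← Real.rpow_add h2k]
  have hkn : (2 : ℝ) ^ k ≤ n := by exact_mod_cast hk
  have hn1 : (1 : ℝ) ≤ n := by exact_mod_cast hn
  rcases le_or_gt (2 - a) 0 with ha | ha
  · calc ((2 : ℝ) ^ k) ^ ((2 : ℝ) + -a) ≤ 1 :=
          Real.rpow_le_one_of_one_le_of_nonpos (one_le_pow₀ (by norm_num)) (by linarith)
      _ ≤ (n : ℝ) ^ max 0 (2 - a) := Real.one_le_rpow hn1 (le_max_left _ _)
  · rw [max_eq_right ha.le, show (2 : ℝ) + -a = 2 - a by ring]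
    exact Real.rpow_le_rpow h2k.le hkn ha.le

/-- The number of dyadic scales is subpolynomial: `log₂ n + 1 ≤ (1 + 2/δ) n^δ` for `n ≥ 1`, `δ > 0`. -/
theorem natLog_two_le {n : ℕ} (hn : 1 ≤ n) {δ : ℝ} (hδ : 0 < δ) :
    ((Nat.log 2 n : ℕ) : ℝ) + 1 ≤ (1 + 2 / δ) * (n : ℝ) ^ δ := by
  have hn0 : n ≠ 0 := by omega
  have hpow : ((2 ^ Nat.log 2 n : ℕ) : ℝ) ≤ n := by exact_mod_cast Nat.pow_log_le_self 2 hn0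
  have hnpos : (0 : ℝ) < n := by exact_mod_cast (show 0 < n by omega)
  have hlog : (Nat.log 2 n : ℝ) * Real.log 2 ≤ Real.log n := by
    have h := Real.log_le_log (by positivity) hpow
    rwa [Nat.cast_pow, Nat.cast_ofNat, Real.log_pow] at h
  have hlog2 : (1 / 2 : ℝ) < Real.log 2 := by
    have := Real.log_two_gt_d9
    linarith
  have hL0 : 0 ≤ (Nat.log 2 n : ℝ) := Nat.cast_nonneg _
  have hL : (Nat.log 2 n : ℝ) ≤ 2 * Real.log n := by nlinarith
  have hlogn : Real.log n ≤ (n : ℝ) ^ δ / δ := Real.log_le_rpow_div hnpos.le hδ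
  have h1 : (1 : ℝ) ≤ (n : ℝ) ^ δ := Real.one_le_rpow (by exact_mod_cast hn) hδ.le
  calc (Nat.log 2 n : ℝ) + 1 ≤ 2 * ((n : ℝ) ^ δ / δ) + (n : ℝ) ^ δ := by linarith
    _ = (1 + 2 / δ) * (n : ℝ) ^ δ := by
        field_simp
        ring

/-! ### Dyadic averaging -/

/-- **Dyadic averaging.** Let `f` be antitone with `f m ≤ C₂ m^γ e_m` for `m ≥ N₀` (`γ, C₂ ≥ 0`, `e ≥ 0`) and
`Σ_{m=N}^{2N} e_m ≤ C_t N^{t-2}` (`C_t ≥ 0`). Then for `N ≥ max N₀ 1`: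
`f (2N) ≤ C₂ 2^γ C_t N^{γ + t - 3}` (since `(N+1) f(2N) ≤ Σ_{m=N}^{2N} f m ≤ C₂ (2N)^γ Σ e_m`). -/
theorem even_bound {f e : ℕ → ℝ} {γ t C₂ Ct : ℝ} {N₀ N : ℕ} (hγ : 0 ≤ γ) (hC₂ : 0 ≤ C₂) (hCt : 0 ≤ Ct)
    (he : ∀ m, 0 ≤ e m) (hanti : ∀ m m' : ℕ, m ≤ m' → f m' ≤ f m)
    (hstep : ∀ m : ℕ, N₀ ≤ m → f m ≤ C₂ * (m : ℝ) ^ γ * e m)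
    (hsum : ∑ m ∈ Finset.Icc N (2 * N), e m ≤ Ct * (N : ℝ) ^ (t - 2))
    (hN₀ : N₀ ≤ N) (hN : 1 ≤ N) :
    f (2 * N) ≤ C₂ * (2 : ℝ) ^ γ * Ct * (N : ℝ) ^ (γ + t - 3) := by
  set I := Finset.Icc N (2 * N) with hI
  have hcard : I.card = N + 1 := by
    rw [hI, Nat.card_Icc]
    omega
  have hNpos : (0 : ℝ) < N := by exact_mod_cast hN
  -- lower bound: `(N+1) f(2N) ≤ Σ f`
  have hlow : ((N : ℝ) + 1) * f (2 * N) ≤ ∑ m ∈ I, f m := by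
    have h := Finset.card_nsmul_le_sum I f (f (2 * N))
      (fun m hm => hanti m (2 * N) (Finset.mem_Icc.1 hm).2)
    rw [hcard, nsmul_eq_mul] at h
    push_cast at h
    exact h
  -- upper bound: `Σ f ≤ C₂ (2N)^γ C_t N^{t-2}`
  have hup : ∑ m ∈ I, f m ≤ C₂ * (2 * (N : ℝ)) ^ γ * (Ct * (N : ℝ) ^ (t - 2)) := by
    calc ∑ m ∈ I, f m ≤ ∑ m ∈ I, C₂ * (2 * (N : ℝ)) ^ γ * e m := by
          refine Finset.sum_le_sum fun m hm => ?_
          have hmI := Finset.mem_Icc.1 hm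
          have hmγ : (m : ℝ) ^ γ ≤ (2 * (N : ℝ)) ^ γ :=
            Real.rpow_le_rpow (Nat.cast_nonneg _) (by exact_mod_cast hmI.2) hγ
          calc f m ≤ C₂ * (m : ℝ) ^ γ * e m := hstep m (hN₀.trans hmI.1)
            _ ≤ C₂ * (2 * (N : ℝ)) ^ γ * e m :=
                mul_le_mul_of_nonneg_right (mul_le_mul_of_nonneg_left hmγ hC₂) (he m)
      _ = C₂ * (2 * (N : ℝ)) ^ γ * ∑ m ∈ I, e m := by rw [Finset.mul_sum]
      _ ≤ C₂ * (2 * (N : ℝ)) ^ γ * (Ct * (N : ℝ) ^ (t - 2)) :=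
          mul_le_mul_of_nonneg_left hsum (by positivity)
  have hmul : (2 * (N : ℝ)) ^ γ = (2 : ℝ) ^ γ * (N : ℝ) ^ γ := Real.mul_rpow (by norm_num) hNpos.le
  have hexp : (N : ℝ) ^ (γ + t - 3) = (N : ℝ) ^ γ * (N : ℝ) ^ (t - 2) * (N : ℝ)⁻¹ := by
    rw [show γ + t - 3 = γ + (t - 2) + (-1) by ring, Real.rpow_add hNpos, Real.rpow_add hNpos,
      Real.rpow_neg_one]
  set M : ℝ := C₂ * (2 : ℝ) ^ γ * Ct * ((N : ℝ) ^ γ * (N : ℝ) ^ (t - 2)) with hM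
  have hM0 : 0 ≤ M := by positivity
  have key : ((N : ℝ) + 1) * f (2 * N) ≤ M := by
    calc ((N : ℝ) + 1) * f (2 * N) ≤ _ := hlow.trans hup
      _ = M := by rw [hmul, hM]; ring
  have h1 : f (2 * N) ≤ M / ((N : ℝ) + 1) := by
    rw [le_div_iff₀ (by positivity)]
    linarith
  calc f (2 * N) ≤ M / ((N : ℝ) + 1) := h1
    _ ≤ M / (N : ℝ) := div_le_div_of_nonneg_left hM0 hNpos (by linarith)
    _ = C₂ * (2 : ℝ) ^ γ * Ct * (N : ℝ) ^ (γ + t - 3) := by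
        rw [hexp, hM]
        ring

/-! ### From even scales to all `n ≥ 1` -/

/-- From the even scales to every `n ≥ 1`: if `f (2N) ≤ C₃ N^{-β}` for `N ≥ N₁ ≥ 1`, `f` is antitone and
`f ≤ 1`, then `f n ≤ C n^{-β}` for all `n ≥ 1` (for `n ≥ 2N₁` use `N = ⌊n/2⌋ ∈ [n/3, n]`; small `n` are
absorbed in the constant; `β` may have either sign). -/
theorem decay_of_eventually {f : ℕ → ℝ} {β C₃ : ℝ} {N₁ : ℕ} (hN₁ : 1 ≤ N₁)
    (hf1 : ∀ n, f n ≤ 1) (hanti : ∀ m m' : ℕ, m ≤ m' → f m' ≤ f m)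
    (h : ∀ N : ℕ, N₁ ≤ N → f (2 * N) ≤ C₃ * (N : ℝ) ^ (-β)) :
    ∃ C : ℝ, ∀ n : ℕ, 1 ≤ n → f n ≤ C * (n : ℝ) ^ (-β) := by
  refine ⟨max (max C₃ 0 * max 1 ((3 : ℝ) ^ β)) (max 1 ((2 * (N₁ : ℝ)) ^ β)), fun n hn => ?_⟩
  have hnpos : (0 : ℝ) < n := by exact_mod_cast hn
  have hnβ : 0 < (n : ℝ) ^ (-β) := Real.rpow_pos_of_pos hnpos _
  rcases lt_or_ge n (2 * N₁) with hsmall | hlarge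
  · -- small `n`: `f n ≤ 1 ≤ max 1 ((2N₁)^β) n^{-β}`
    have hle : (n : ℝ) ^ β ≤ max 1 ((2 * (N₁ : ℝ)) ^ β) := by
      rcases le_or_gt 0 β with hb | hb
      · exact (Real.rpow_le_rpow hnpos.le (by exact_mod_cast hsmall.le) hb).trans (le_max_right _ _)
      · exact (Real.rpow_le_one_of_one_le_of_nonpos (by exact_mod_cast hn) hb.le).trans (le_max_left _ _)
    have hnb : (n : ℝ) ^ β * (n : ℝ) ^ (-β) = 1 := by
      rw [Real.rpow_neg hnpos.le, mul_inv_cancel₀ (Real.rpow_pos_of_pos hnpos β).ne']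
    calc f n ≤ 1 := hf1 n
      _ = (n : ℝ) ^ β * (n : ℝ) ^ (-β) := hnb.symm
      _ ≤ max 1 ((2 * (N₁ : ℝ)) ^ β) * (n : ℝ) ^ (-β) := mul_le_mul_of_nonneg_right hle hnβ.le
      _ ≤ _ := mul_le_mul_of_nonneg_right (le_max_right _ _) hnβ.le
  · -- large `n`: `N := n / 2`
    set N := n / 2 with hNdef
    have hN₁N : N₁ ≤ N := by omega
    have hNpos : (0 : ℝ) < N := by exact_mod_cast (show 0 < N by omega)
    have h2N : 2 * N ≤ n := by omega
    have h3N : n ≤ 3 * N := by omega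
    have hfn : f n ≤ C₃ * (N : ℝ) ^ (-β) := (hanti _ _ h2N).trans (h N hN₁N)
    have hNn : (N : ℝ) ^ (-β) ≤ max 1 ((3 : ℝ) ^ β) * (n : ℝ) ^ (-β) := by
      rcases le_or_gt 0 β with hb | hb
      · have h13 : (n : ℝ) / 3 ≤ N := by
          rw [div_le_iff₀ (by norm_num : (0 : ℝ) < 3)]
          exact_mod_cast (by omega : n ≤ N * 3)
        calc (N : ℝ) ^ (-β) ≤ ((n : ℝ) / 3) ^ (-β) :=
              Real.rpow_le_rpow_of_nonpos (by positivity) h13 (by linarith)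
          _ = (3 : ℝ) ^ β * (n : ℝ) ^ (-β) := by
              rw [Real.div_rpow hnpos.le (by norm_num), Real.rpow_neg (by norm_num : (0 : ℝ) ≤ 3),
                div_eq_mul_inv, inv_inv, mul_comm]
          _ ≤ _ := mul_le_mul_of_nonneg_right (le_max_right _ _) hnβ.le
      · calc (N : ℝ) ^ (-β) ≤ (n : ℝ) ^ (-β) :=
              Real.rpow_le_rpow hNpos.le (by exact_mod_cast (show N ≤ n by omega)) (by linarith)
          _ = 1 * (n : ℝ) ^ (-β) := (one_mul _).symm
          _ ≤ _ := mul_le_mul_of_nonneg_right (le_max_left _ _) hnβ.le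
    calc f n ≤ C₃ * (N : ℝ) ^ (-β) := hfn
      _ ≤ max C₃ 0 * (N : ℝ) ^ (-β) :=
          mul_le_mul_of_nonneg_right (le_max_left _ _) (Real.rpow_nonneg hNpos.le _)
      _ ≤ max C₃ 0 * (max 1 ((3 : ℝ) ^ β) * (n : ℝ) ^ (-β)) :=
          mul_le_mul_of_nonneg_left hNn (le_max_right _ _)
      _ = (max C₃ 0 * max 1 ((3 : ℝ) ^ β)) * (n : ℝ) ^ (-β) := by ring
      _ ≤ _ := mul_le_mul_of_nonneg_right (le_max_left _ _) hnβ.le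

end StubStep

/-- **Registered sub-goal `stub_step_sums`** (def-free summary of this helper file): from the even scales to
every `n ≥ 1` — if `f (2N) ≤ C₃ N^{-β}` for `N ≥ N₁ ≥ 1`, `f` is antitone and `f ≤ 1`, then
`f n ≤ C n^{-β}` for all `n ≥ 1` (`StubStep.decay_of_eventually`). -/
theorem stub_step_sums : ∀ (f : ℕ → ℝ) (β C₃ : ℝ) (N₁ : ℕ), 1 ≤ N₁ → (∀ n : ℕ, f n ≤ 1) → (∀ m m' : ℕ, m ≤ m' → f m' ≤ f m) → (∀ N : ℕ, N₁ ≤ N → f (2 * N) ≤ C₃ * (N : ℝ) ^ (-β)) → ∃ C : ℝ, ∀ n : ℕ, 1 ≤ n → f n ≤ C * (n : ℝ) ^ (-β) :=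
  fun _ _ _ _ hN₁ hf1 hanti h => StubStep.decay_of_eventually hN₁ hf1 hanti h

end Summit.CriticalPhenomena.PercolationContinuityZ3.Theorems.BoundaryTwoArmDecay
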